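import Summits.QuantumFields.YangMills.Theorems.SoloBlindMaxwellCovariance
import HarnessLib

/-!
# SoloBlind — D17b: the Maxwell plaquette covariance as a product-measure integral

Soloist seat `solo-QuantumFields-blind` (session s23).  A supplement to rung D17
(`SoloBlindMaxwellCovariance`): there the lattice Maxwell plaquette covariance was DEFINED as the
iterated integral
`maxwellCov m D n = ((2π)^{m+1})⁻¹ ∫_{[-π,π]^m} (∫_{-π}^{π} N_D(θ) cos(n t)/(E(θ) + ŝ(t)) dt) dθ`
(spatial momenta outside, the momentum along the separation axis inside), because that is the
order in which the transfer-matrix representation is read off.  This file records that the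
integrand is bounded by `1` in absolute value and measurable, hence integrable on the Brillouin
zone `[-π,π]^m × [-π,π]`, and that by Fubini `maxwellCov m D n` equals the genuine
`(m+1)`-dimensional momentum-space integral
`((2π)^{m+1})⁻¹ ∫_{[-π,π]^m × [-π,π]} N_D(θ) cos(n t)/(E(θ) + ŝ(t)) d(θ,t)`
(`maxwellCov_eq_integral_prod`) — the textbook Fourier formula for the plaquette two-point
function of free lattice Maxwell theory in `d = m + 1` dimensions (real part; the imaginary part
vanishes by `t ↦ -t`).  Its identification with the infinite-volume limit of finite-torus
covariances is part of the hypothesis `HasScaledCovarianceLimit` (paper Theorem A), not of this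
file.  No summit claim is made here.
-/

open Real MeasureTheory Set Filter Topology intervalIntegral

noncomputable section

namespace Summit.QuantumFields.YangMills.Theorems.SoloBlind

variable {m : ℕ}

/-- The momentum-space integrand `N_D(θ) cos(n t) / (E(θ) + ŝ(t))` on `ℝ^m × ℝ`
(spatial momentum `θ`, momentum `t` along the separation axis). -/
def maxwellIntegrand (D : Finset (Fin m)) (n : ℕ) (z : (Fin m → ℝ) × ℝ) : ℝ :=
  plaqNum D z.1 * Real.cos ((n : ℝ) * z.2) / (energy z.1 + sHat z.2)

/-- `|N_D(θ) cos(n t) / (E(θ) + ŝ(t))| ≤ 1` (`N_D ≤ E`, `|cos| ≤ 1`; at `E + ŝ = 0` the value is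
the junk value `0`). -/
theorem abs_maxwellIntegrand_le_one (D : Finset (Fin m)) (n : ℕ) (z : (Fin m → ℝ) × ℝ) :
    |maxwellIntegrand D n z| ≤ 1 := by
  unfold maxwellIntegrand
  rcases (add_nonneg (energy_nonneg z.1) (sHat_nonneg z.2)).eq_or_lt with h | h
  · rw [← h, div_zero, abs_zero]; exact zero_le_one
  · rw [abs_div, abs_of_pos h, div_le_one h, abs_mul, abs_of_nonneg (plaqNum_nonneg D z.1)]
    calc plaqNum D z.1 * |Real.cos ((n : ℝ) * z.2)| ≤ plaqNum D z.1 * 1 :=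
          mul_le_mul_of_nonneg_left (Real.abs_cos_le_one _) (plaqNum_nonneg D z.1)
      _ ≤ energy z.1 + sHat z.2 := by linarith [plaqNum_le_energy D z.1, sHat_nonneg z.2]

/-- The integrand is measurable. -/
theorem measurable_maxwellIntegrand (D : Finset (Fin m)) (n : ℕ) :
    Measurable (maxwellIntegrand D n) := by
  have h1 : Continuous fun z : (Fin m → ℝ) × ℝ => plaqNum D z.1 * Real.cos ((n : ℝ) * z.2) := by
    fun_prop
  have h2 : Continuous fun z : (Fin m → ℝ) × ℝ => energy z.1 + sHat z.2 := by
    unfold energy; fun_prop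
  exact h1.measurable.div h2.measurable

/-- The integrand is integrable on the Brillouin zone `[-π,π]^m × [-π,π]`. -/
theorem integrableOn_maxwellIntegrand (D : Finset (Fin m)) (n : ℕ) :
    IntegrableOn (maxwellIntegrand D n) (cube m ×ˢ Set.Icc (-π) π)
      ((volume : Measure (Fin m → ℝ)).prod volume) := by
  refine Measure.integrableOn_of_bounded (M := 1) ?_
    (measurable_maxwellIntegrand D n).aestronglyMeasurable (ae_of_all _ fun z => ?_)
  · rw [Measure.prod_prod, volume_cube, Real.volume_Icc]
    exact ENNReal.mul_ne_top (ENNReal.pow_ne_top ENNReal.ofReal_ne_top) ENNReal.ofReal_ne_top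
  · rw [Real.norm_eq_abs]; exact abs_maxwellIntegrand_le_one D n z

/-- **Fubini form of the Maxwell plaquette covariance.**
`maxwellCov m D n = ((2π)^{m+1})⁻¹ ∫_{[-π,π]^m × [-π,π]} N_D(θ) cos(n t)/(E(θ) + ŝ(t)) d(θ, t)`,
the integral taken against Lebesgue measure on `ℝ^m × ℝ`. -/
theorem maxwellCov_eq_integral_prod (D : Finset (Fin m)) (n : ℕ) :
    maxwellCov m D n =
      ((2 * π) ^ (m + 1))⁻¹ * ∫ z in cube m ×ˢ Set.Icc (-π) π, maxwellIntegrand D n z := by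
  unfold maxwellCov
  congr 1
  rw [Measure.volume_eq_prod, setIntegral_prod _ (integrableOn_maxwellIntegrand D n)]
  have hcube : MeasurableSet (cube m) := MeasurableSet.univ_pi fun _ => measurableSet_Icc
  refine (setIntegral_congr_fun hcube fun θ _ => ?_).symm
  simp only [maxwellIntegrand]
  rw [axisCov, intervalIntegral.integral_of_le (by linarith [pi_pos]), integral_Icc_eq_integral_Ioc]

end Summit.QuantumFields.YangMills.Theorems.SoloBlind

end
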